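import Summits.ValiantsHypothesis.ValiantsHypothesis.Theorems.BarrierLeverPartitionMinorsHitByVPHiddenStatesShadowRankExpansion

/-!
# Route BarrierLever — item `PartitionMinorsHitByVP` (stmt-ValiantsHypothesis-19717), line `hidden_states`:
# THE SHADOW-RANK BOUND — level-`t` columns against rows of size `≤ s` span at most `|∂_{t-1}| · |B_{⌊s/t⌋}(T)|` dimensions

Helper file (`--supports stmt-ValiantsHypothesis-19717`; cell valiant-natproofs, rung V4, 𝒟-side door (c), line
`hidden_states`, node #1 `stub_universalJoinWide`; prover seat val-np-p3 gen 19). Definition-free apart from bookkeeping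
`def`s (the column-function index, the column-functions, the row coefficients); the entry expansion is part 1
(`…HiddenStatesShadowRankExpansion`). Closes NO item: it is the every-level form of
the triple-row bound (`…HiddenStatesTripleRank`, `t = 2, s = 3`) and of the five-row bound (`…HiddenStatesFiveRank`,
`t = 2, s = 5`, whose count `2·|S|·|B₂(T)|` it HALVES), valid for JOINS (every piece with its own table) — the kernel side
of the seat's «shadow-rank principle» (memo HOME/val-np-p3/g19/MEMO-hybrid-valnp3-g19.md §7c).

THE BOUND. Pieces `x : Fin m` with tables `tx x : Option (Fin K) → Fin h → ℂ` (`none` = the constant), columns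
`e k = (x, J)` (a piece and a set of its states), rows `u i ⊆ T` of size `≤ s`, entries
`∏_{a ∈ u i} (tx x none a + Σ_{p ∈ J} tx x (some p) a)`. Fix a level `t ≥ 1` and `q` with `s < t (q + 1)` (i.e.
`q ≥ ⌊s/t⌋`). Expanding the product over assignments `f : u i → J ⊔ {none}`, SOME state `p ∈ J` receives a part
`V = f⁻¹(p)` of size `≤ q` (pigeonhole), and averaging over all such `p` with weight `1/#{p : |f⁻¹ p| ≤ q}` writes the
entry of a level-`t` column as

  `Σ_{p ∈ J} Σ_{V ⊆ T, |V| ≤ q}  coef(u i; x, J ∖ p, V) · ∏_{a ∈ V} tx x (some p) a`      (`prod_eq_sum_coef`)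

with a coefficient depending only on the row, the piece, the `(t−1)`-set `J ∖ p` and `V` — NOT on `p`. Hence every
row, restricted to the level-`t` columns, lies in the span of the column-functions `k ↦ [T' ⊆ J_k]·∏_{a∈V} tx x (J_k ∖ T') a`
indexed by `Sh × B_q(T)`, `Sh ⊇` the `(t−1)`-shadow of the level-`t` columns (with pieces), and (`det_eq_zero`): if

  `#{k : |J_k| ≠ t} + |Sh| · #{V ⊆ T : |V| ≤ q} < #columns`

the matrix is SINGULAR FOR EVERY TABLE. One piece: `det_eq_zero_onePiece`; `t = 2`, `s = 5`, `q = 2` is the five-row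
bound with HALF its count (`det_eq_zero_pairs_five`). Consequences recorded in the memo: a complete block `C(M, t)` in
any piece facing rows of size `≤ s` with `⌊s/t⌋ = 2` forces `|M| ≤ t·|B₂(h)| + t − 1 ≈ t h²/2`; the flat (ball–colex)
design on any fixed polynomial number of states is singular in every regime for large `h`; the counts add over pieces.
WHAT THIS IS NOT: no statement about spread top layers (full shadow), nothing on crux 14610 or VP ≠ VNP.
-/

set_option linter.dupNamespace false

namespace Summit.ValiantsHypothesis.ValiantsHypothesis.Theorems.BarrierLever.HiddenStates

open Finset

noncomputable section

namespace ShadowRank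

variable {K h : ℕ}

/-! ## Column-functions and the span -/

section span

variable {m : ℕ} {n : Type*} (u : n → Finset (Fin h)) (e : n → Fin m × Finset (Fin K))
  (T : Finset (Fin h)) (Sh : Finset (Fin m × Finset (Fin K))) (t q : ℕ)
  (tx : Fin m → Option (Fin K) → Fin h → ℂ)

/-- The small subsets of `T` (index of the monomials `V`). -/
def smallSets (T : Finset (Fin h)) (q : ℕ) : Finset (Finset (Fin h)) := T.powerset.filter fun V => V.card ≤ q

/-- Index of the column-functions: the columns off level `t` (counted one by one) and the pairs (shadow member, monomial). -/
abbrev ColIdx := {k : n // ((e k).2).card ≠ t} ⊕ (↥Sh × ↥(smallSets T q))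

/-- The column-functions. -/
def colVec [DecidableEq n] : ColIdx e T Sh t q → (n → ℂ)
  | Sum.inl k₀ => fun k => if k = k₀.1 then 1 else 0
  | Sum.inr (σ, V) => fun k =>
      if (e k).1 = σ.1.1 ∧ (σ.1.2 : Finset (Fin K)) ⊆ (e k).2 ∧ ((e k).2).card = t ∧ (σ.1.2 : Finset (Fin K)).card + 1 = t
      then ∑ p ∈ (e k).2 \ σ.1.2, ∏ a ∈ (V : Finset (Fin h)), tx (e k).1 (some p) a else 0

/-- The coefficients of the row `i` on the column-functions. -/
def rowCoef (i : n) : ColIdx e T Sh t q → ℂ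
  | Sum.inl k₀ => ∏ a ∈ u i, (tx (e k₀.1).1 none a + ∑ p ∈ (e k₀.1).2, tx (e k₀.1).1 (some p) a)
  | Sum.inr (σ, V) => coef q (tx σ.1.1) (u i) σ.1.2 V

variable [Fintype n] [DecidableEq n]

/-- **Every row is the stated combination of the column-functions.** -/
theorem row_eq_sum {s : ℕ} (hst : s < t * (q + 1))
    (hSh : ∀ k, ((e k).2).card = t → ∀ p ∈ (e k).2, ((e k).1, ((e k).2).erase p) ∈ Sh)
    (i : n) (hiT : u i ⊆ T) (his : (u i).card ≤ s) (k : n) :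
    ∏ a ∈ u i, (tx (e k).1 none a + ∑ p ∈ (e k).2, tx (e k).1 (some p) a) =
      ∑ idx : ColIdx e T Sh t q, rowCoef u e T Sh t q tx i idx * colVec e T Sh t q tx idx k := by
  classical
  rw [Fintype.sum_sum_type]
  by_cases hk : ((e k).2).card = t
  · -- a level-`t` column: the `inl` part vanishes, the `inr` part is the expansion
    have hinl : ∑ k₀ : {k : n // ((e k).2).card ≠ t},
        rowCoef u e T Sh t q tx i (Sum.inl k₀) * colVec e T Sh t q tx (Sum.inl k₀) k = 0 := by
      refine Finset.sum_eq_zero fun k₀ _ => ?_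
      have : k ≠ k₀.1 := fun hkk => k₀.2 (hkk ▸ hk)
      simp [colVec, this]
    rw [hinl, zero_add, prod_eq_sum_coef hst (tx (e k).1) hiT his hk, Fintype.sum_prod_type]
    -- the summands as a plain function of (shadow member, monomial)
    set G : (Fin m × Finset (Fin K)) → Finset (Fin h) → ℂ := fun σ V =>
      coef q (tx σ.1) (u i) σ.2 V *
        (if (e k).1 = σ.1 ∧ σ.2 ⊆ (e k).2 ∧ ((e k).2).card = t ∧ σ.2.card + 1 = t
          then ∑ p ∈ (e k).2 \ σ.2, ∏ a ∈ V, tx (e k).1 (some p) a else 0) with hG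
    have hR : (∑ x : ↥Sh, ∑ y : ↥(smallSets T q),
        rowCoef u e T Sh t q tx i (Sum.inr (x, y)) * colVec e T Sh t q tx (Sum.inr (x, y)) k) =
        ∑ σ ∈ Sh, ∑ V ∈ smallSets T q, G σ V := by
      rw [← Finset.sum_coe_sort Sh]
      refine Fintype.sum_congr _ _ fun x => ?_
      rw [← Finset.sum_coe_sort (smallSets T q)]
      rfl
    rw [hR]
    -- restrict the outer sum to the image of `p ↦ ((e k).1, J.erase p)` (all other summands vanish)
    have himg : ((e k).2).image (fun p => ((e k).1, ((e k).2).erase p)) ⊆ Sh := by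
      intro σ hσ
      obtain ⟨p, hp, rfl⟩ := Finset.mem_image.mp hσ
      exact hSh k hk p hp
    have hzero : ∀ σ ∈ Sh, σ ∉ ((e k).2).image (fun p => ((e k).1, ((e k).2).erase p)) →
        ∑ V ∈ smallSets T q, G σ V = 0 := by
      intro σ _ hσn
      refine Finset.sum_eq_zero fun V _ => ?_
      simp only [hG]
      rw [if_neg, mul_zero]
      rintro ⟨h1, h2, h3, h4⟩
      apply hσn
      have hcard : (((e k).2) \ σ.2).card = 1 := by
        have := Finset.card_sdiff_add_card_eq_card h2
        omega
      obtain ⟨p, hp⟩ := Finset.card_eq_one.mp hcard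
      have hpJ : p ∈ (e k).2 ∧ p ∉ σ.2 := by
        have : p ∈ (e k).2 \ σ.2 := by rw [hp]; exact Finset.mem_singleton_self p
        exact Finset.mem_sdiff.mp this
      refine Finset.mem_image.mpr ⟨p, hpJ.1, Prod.ext h1 ?_⟩
      ext a
      simp only [Finset.mem_erase]
      constructor
      · rintro ⟨hap, haJ⟩
        by_contra haσ
        have : a ∈ (e k).2 \ σ.2 := Finset.mem_sdiff.mpr ⟨haJ, haσ⟩
        rw [hp, Finset.mem_singleton] at this
        exact hap this
      · intro haσ
        exact ⟨fun hap => hpJ.2 (hap ▸ haσ), h2 haσ⟩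
    rw [← Finset.sum_subset himg hzero, Finset.sum_image]
    · refine Finset.sum_congr rfl fun p hp => Finset.sum_congr rfl fun V _ => ?_
      have hcond : ((e k).2).erase p ⊆ (e k).2 ∧ ((e k).2).card = t ∧
          (((e k).2).erase p).card + 1 = t :=
        ⟨Finset.erase_subset _ _, hk, by rw [Finset.card_erase_add_one hp, hk]⟩
      have hsd : (e k).2 \ ((e k).2).erase p = {p} := by
        ext a
        simp only [Finset.mem_sdiff, Finset.mem_erase, Finset.mem_singleton, not_and]
        constructor
        · rintro ⟨ha, hne⟩
          by_contra hap
          exact hne hap ha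
        · rintro rfl
          exact ⟨hp, fun h _ => h rfl⟩
      simp only [hG, true_and, if_pos hcond, hsd, Finset.sum_singleton]
    · intro p hp p' hp' hpp
      exact Finset.erase_injOn _ hp hp' (Prod.mk.inj hpp).2
  · -- a column off level `t`: only its own indicator survives
    have hinr : ∑ σV : ↥Sh × ↥(smallSets T q),
        rowCoef u e T Sh t q tx i (Sum.inr σV) * colVec e T Sh t q tx (Sum.inr σV) k = 0 := by
      refine Finset.sum_eq_zero fun σV _ => ?_
      obtain ⟨σ, V⟩ := σV
      simp [colVec, hk]
    rw [hinr, add_zero]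
    rw [Finset.sum_eq_single ⟨k, hk⟩]
    · simp [rowCoef, colVec]
    · intro k₀ _ hk₀
      have : k ≠ k₀.1 := fun hkk => hk₀ (Subtype.ext hkk.symm)
      simp [colVec, this]
    · simp

/-- **Every row of size `≤ s` inside `T` lies in the span of the column-functions.** -/
theorem row_mem_span {s : ℕ} (hst : s < t * (q + 1))
    (hSh : ∀ k, ((e k).2).card = t → ∀ p ∈ (e k).2, ((e k).1, ((e k).2).erase p) ∈ Sh)
    (i : n) (hiT : u i ⊆ T) (his : (u i).card ≤ s) :
    (fun k => ∏ a ∈ u i, (tx (e k).1 none a + ∑ p ∈ (e k).2, tx (e k).1 (some p) a)) ∈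
      Submodule.span ℂ (Set.range (colVec e T Sh t q tx)) := by
  classical
  have hfun : (fun k => ∏ a ∈ u i, (tx (e k).1 none a + ∑ p ∈ (e k).2, tx (e k).1 (some p) a)) =
      ∑ idx : ColIdx e T Sh t q, rowCoef u e T Sh t q tx i idx • colVec e T Sh t q tx idx := by
    funext k
    rw [Finset.sum_apply]
    simp only [Pi.smul_apply, smul_eq_mul]
    exact row_eq_sum u e T Sh t q tx hst hSh i hiT his k
  rw [hfun]
  exact Submodule.sum_mem _ fun idx _ => Submodule.smul_mem _ _ (Submodule.subset_span ⟨idx, rfl⟩)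

omit [DecidableEq n] in
/-- The number of column-functions. -/
theorem card_colIdx : Fintype.card (ColIdx e T Sh t q) =
    (Finset.univ.filter fun k => ((e k).2).card ≠ t).card + Sh.card * (smallSets T q).card := by
  classical
  rw [Fintype.card_sum, Fintype.card_prod, Fintype.card_coe, Fintype.card_coe, Fintype.card_subtype]

/-- **THE SHADOW-RANK BOUND, singular form (joins).** Rows of size `≤ s` inside `T`, a level `t` with `s < t (q+1)`,
`Sh` containing the `(t−1)`-shadow (with pieces) of the level-`t` columns: if the columns off level `t` plus
`|Sh| · #{V ⊆ T : |V| ≤ q}` are FEWER than the columns, the block-additive matrix is singular for every table. -/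
theorem det_eq_zero {s : ℕ} (hst : s < t * (q + 1))
    (hSh : ∀ k, ((e k).2).card = t → ∀ p ∈ (e k).2, ((e k).1, ((e k).2).erase p) ∈ Sh)
    (huT : ∀ i, u i ⊆ T) (hus : ∀ i, (u i).card ≤ s)
    (hcount : (Finset.univ.filter fun k => ((e k).2).card ≠ t).card + Sh.card * (smallSets T q).card <
      Fintype.card n) :
    (Matrix.of fun i k : n =>
      ∏ a ∈ u i, (tx (e k).1 none a + ∑ p ∈ (e k).2, tx (e k).1 (some p) a)).det = 0 := by
  classical
  set M : Matrix n n ℂ := Matrix.of fun i k : n =>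
    ∏ a ∈ u i, (tx (e k).1 none a + ∑ p ∈ (e k).2, tx (e k).1 (some p) a) with hM
  by_contra hdet
  have hunit : IsUnit M := (Matrix.isUnit_iff_isUnit_det M).mpr (isUnit_iff_ne_zero.mpr hdet)
  have hrows : LinearIndependent ℂ (fun i : n => M i) := Matrix.linearIndependent_rows_of_isUnit hunit
  set W : Submodule ℂ (n → ℂ) := Submodule.span ℂ (Set.range (colVec e T Sh t q tx)) with hW
  have hmem : ∀ i : n, M i ∈ W := fun i => row_mem_span u e T Sh t q tx hst hSh i (huT i) (hus i)
  let w : n → W := fun i => ⟨M i, hmem i⟩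
  have hw : LinearIndependent ℂ w := LinearIndependent.of_comp W.subtype hrows
  have h1 : Fintype.card n ≤ Module.finrank ℂ W := hw.fintype_card_le_finrank
  have h2 : Module.finrank ℂ W ≤ Fintype.card (ColIdx e T Sh t q) := finrank_range_le_card (colVec e T Sh t q tx)
  rw [card_colIdx] at h2
  omega

end span

/-! ## One piece; the halved five-row bound -/

section onePiece

variable {n : Type*} [Fintype n] [DecidableEq n]

/-- **One piece.** The shadow-rank bound for a single table: `Sh ⊇` the `(t−1)`-shadow of the level-`t` columns. -/
theorem det_eq_zero_onePiece (t q s : ℕ) (hst : s < t * (q + 1))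
    (u : n → Finset (Fin h)) (e : n → Finset (Fin K)) (T : Finset (Fin h)) (Sh : Finset (Finset (Fin K)))
    (hSh : ∀ k, (e k).card = t → ∀ p ∈ e k, (e k).erase p ∈ Sh)
    (huT : ∀ i, u i ⊆ T) (hus : ∀ i, (u i).card ≤ s)
    (hcount : (Finset.univ.filter fun k => (e k).card ≠ t).card + Sh.card * (smallSets T q).card <
      Fintype.card n)
    (tx : Option (Fin K) → Fin h → ℂ) :
    (Matrix.of fun i k : n => ∏ a ∈ u i, (tx none a + ∑ p ∈ e k, tx (some p) a)).det = 0 := by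
  classical
  have key := det_eq_zero u (fun k => ((0 : Fin 1), e k)) T (Sh.map ⟨fun T' => ((0 : Fin 1), T'),
    fun a b hab => (Prod.mk.inj hab).2⟩) t q (fun _ => tx) hst
    (fun k hk p hp => Finset.mem_map.mpr ⟨(e k).erase p, hSh k hk p hp, rfl⟩) huT hus
    (by rw [Finset.card_map]; exact hcount)
  simpa using key

/-- **The five-row bound, halved** (`t = 2`, `s = 5`, `q = 2`): a hidden family with members of size `≤ 2`, all
two-state members inside `S`, rows of size `≤ 5` inside `T`; singular as soon as
`#{k : |e k| ≠ 2} + |S| · #{V ⊆ T : |V| ≤ 2} < #columns` (the landed `FiveRank.det_eq_zero_of_rows_le_five` needs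
`(K+1) + 2·|S|·#{V ⊆ T : |V| ≤ 2} < #columns`). -/
theorem det_eq_zero_pairs_five (u : n → Finset (Fin h)) (e : n → Finset (Fin K)) (S : Finset (Fin K))
    (T : Finset (Fin h)) (heS : ∀ k, (e k).card = 2 → e k ⊆ S)
    (hu5 : ∀ i, (u i).card ≤ 5) (huT : ∀ i, u i ⊆ T)
    (hcount : (Finset.univ.filter fun k => (e k).card ≠ 2).card + S.card * (smallSets T 2).card <
      Fintype.card n)
    (tx : Option (Fin K) → Fin h → ℂ) :
    (Matrix.of fun i k : n => ∏ a ∈ u i, (tx none a + ∑ p ∈ e k, tx (some p) a)).det = 0 := by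
  classical
  refine det_eq_zero_onePiece 2 2 5 (by norm_num) u e T (S.image fun p => ({p} : Finset (Fin K)))
    (fun k hk p hp => ?_) huT hu5 (lt_of_le_of_lt (Nat.add_le_add_left (Nat.mul_le_mul_right _
      Finset.card_image_le) _) hcount) tx
  -- the shadow of a pair `{p, p'}` is the singleton `{p'}`, `p' ∈ S`
  obtain ⟨p', hp'⟩ : ∃ p', (e k).erase p = {p'} := Finset.card_eq_one.mp (by
    have := Finset.card_erase_add_one hp; omega)
  rw [hp']
  refine Finset.mem_image.mpr ⟨p', heS k hk ?_, rfl⟩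
  exact Finset.mem_of_mem_erase (hp' ▸ Finset.mem_singleton_self p')

end onePiece

end ShadowRank


end

end Summit.ValiantsHypothesis.ValiantsHypothesis.Theorems.BarrierLever.HiddenStates
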